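/-
HONEST FRAMING: certified error envelopes and provably optimal rounding/accumulation schemes for
low-precision formats under stated cost models; every table by two implementations; no hardware
or vendor claims.
-/
import Summits.Ventures.CertifiedArithmetic.LowPrec.OptDemotionRoutingPhi3pArith
import Summits.Ventures.CertifiedArithmetic.LowPrec.OptDemotionRoutingPhi3
import Summits.Ventures.CertifiedArithmetic.LowPrec.OptDemotionRoutingPhi3pOpt

/-!
# The demotion law (Theorem T8), part 10k-b: LEMMA Φ3′ — the two-bit refinement of LEMMA Φ3 — FOR EVERY `q`

  `x_(k-1,l-1) ≤ (1-u) x_(k,l) + m · x_(s,c,c+j) + u m · x_(s,c+j)`,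
  `s = l-k`, `c = q-k`, `u = 2^-q`, `m = 2^-k`, `2 ≤ j < k < l ≤ q-1`, every tree (`treeBR_phi3p`).

This is the ONE new all-`q` row needed by the popcount-3 top-level e-side rows
`E3(j,k,l): x_(j-1,k-1,l-1) ≤ (1-u) x_(j,k,l) + (1+u) t x_(k-j,l-j,q-j)` (lean seat gen 14,
CONJECTURE-D-NODESTEP.md §G14.2: the other seven branches of E3 reduce to R31, LEMMA Φ3, R33,
(MC), gap convexity and (M)).  Proof: tree induction over the three-bit left side (part 10g
`treeBR_three_node_le`, eight options); per option one lemma of part 10k-a (or 10i-a): `{k-1,l-1}` = IH (literally `phi3_branch1`),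
`{k-1}` = LEMMA Φ3(j,k) (part 10i) on `a` + LEMMA B1(q-l,k) on `b`, `{l-1}` = LEMMA Φ3(k,l) on
`a` + LEMMA B1(c,j) on `b`, `∅` = a one-regime closed-form certificate ((MC) at the triple
`{0,-s,-(c+1)}`, the two-bit gap-convexity row `T_{s,c+1} | T_{s,c+j}, T_{s,c}` of part 10d, two
(M) rows).  The four-bit right-hand coordinate `x_(s,c,c+j)` is handled by the general node rule
of part 10k-0 (`injected_le_treeBR_node`, packaged in part 10k-a′ `phi3p_optP3`).  Exact cross-check of the whole scheme for all
`(q,j,k,l)`, `q ≤ 22` (5985 quadruples, 0 failures): sessions work/r33/cert_phi3p.py.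
-/

namespace Summit.Ventures.CertifiedArithmetic.LowPrec.Opt

open Literature.ComputerArithmetic.JeannerodRump2018
open Literature.ComputerArithmetic.JeannerodRump2018.SumTree

section Phi3p

variable {q : ℕ}

/-- **LEMMA Φ3′ FOR EVERY `q`**: for `q ≥ 5`, `2 ≤ j < k < l ≤ q-1` and every tree, with `s = l-k`,
`c = q-k`: `BR_t{0,-(k-1),-(l-1)} ≤ (1-u) BR_t{0,-k,-l} + 2^-k BR_t{0,-s,-c,-(c+j)} +
u 2^-k BR_t{0,-s,-(c+j)}`. -/
theorem treeBR_phi3p (hq : 5 ≤ q) {j k l : ℕ} (hj : 2 ≤ j) (hjk : j < k) (hkl : k < l) (hlq : l + 1 ≤ q) :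
    ∀ t : SumTree,
    treeBR q t {0, -((k : ℤ) - 1), -((l : ℤ) - 1)} ≤
      (1 - unitRoundoff q) * treeBR q t {0, -(k : ℤ), -(l : ℤ)} +
        (2 : ℚ) ^ (-(k : ℤ)) * treeBR q t {0, -((l : ℤ) - k), -((q : ℤ) - k), -((q : ℤ) - k + j)} +
          unitRoundoff q * (2 : ℚ) ^ (-(k : ℤ)) * treeBR q t {0, -((l : ℤ) - k), -((q : ℤ) - k + j)} := by
  have hq1 : 1 ≤ q := by omega
  have hq4 : 4 ≤ q := by omega
  obtain ⟨c, hc⟩ : ∃ c : ℕ, (c : ℤ) = (q : ℤ) - k := ⟨q - k, by omega⟩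
  obtain ⟨s, hs⟩ : ∃ s : ℕ, (s : ℤ) = (l : ℤ) - k := ⟨l - k, by omega⟩
  obtain ⟨dl, hdl⟩ : ∃ dl : ℕ, (dl : ℤ) = (q : ℤ) - l := ⟨q - l, by omega⟩
  have hc1 : 2 ≤ c := by omega
  have hs1 : 1 ≤ s := by omega
  have hsc : s + 1 ≤ c := by omega
  have hdl1 : 1 ≤ dl := by omega
  rw [← hc, ← hs]
  set u := unitRoundoff q with hudef
  set m : ℚ := (2 : ℚ) ^ (-(k : ℤ)) with hmdef
  set t : ℚ := (2 : ℚ) ^ (-(j : ℤ)) with htdef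
  set g : ℚ := (2 : ℚ) ^ (-(s : ℤ)) with hgdef
  ------------------------------------------------------------------ scalar facts
  have huz : u = (2 : ℚ) ^ (-(q : ℤ)) := unitRoundoff_eq_zpow q
  have hu0 : 0 < u := by rw [huz]; exact zpow_pos (by norm_num) _
  have hm0 : 0 < m := zpow_pos (by norm_num) _
  have ht0 : 0 < t := zpow_pos (by norm_num) _
  have hg0 : 0 < g := zpow_pos (by norm_num) _
  have two_mul_zpow : ∀ e : ℤ, (2 : ℚ) * (2 : ℚ) ^ e = (2 : ℚ) ^ (e + 1) := fun e => by
    rw [zpow_add_one₀ (by norm_num)]; ring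
  have pw : ∀ a b : ℤ, (2 : ℚ) ^ a * (2 : ℚ) ^ b = (2 : ℚ) ^ (a + b) := fun a b =>
    (zpow_add₀ (by norm_num) a b).symm
  have hmu : 2 * u ≤ m := by
    rw [huz, hmdef, two_mul_zpow]; exact zpow_le_zpow_right₀ (by norm_num) (by omega)
  have htm : 2 * m ≤ t := by
    rw [htdef, hmdef, two_mul_zpow]; exact zpow_le_zpow_right₀ (by norm_num) (by omega)
  have ht4 : t ≤ 1 / 4 := by
    rw [htdef]
    have : (2 : ℚ) ^ (-(j : ℤ)) ≤ (2 : ℚ) ^ (-2 : ℤ) := zpow_le_zpow_right₀ (by norm_num) (by omega)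
    have e : (2 : ℚ) ^ (-2 : ℤ) = 1 / 4 := by norm_num
    rwa [e] at this
  have hml : m * g = (2 : ℚ) ^ (-(l : ℤ)) := by rw [hmdef, hgdef, pw]; congr 1; omega
  have hgm : 2 * u ≤ g * m := by
    rw [mul_comm g m, hml, huz, two_mul_zpow]; exact zpow_le_zpow_right₀ (by norm_num) (by omega)
  have hu1 : u ≤ 1 := unitRoundoff_le_one q
  have hcm : m * (2 : ℚ) ^ (-(c : ℤ)) = u := by rw [hmdef, huz, pw]; congr 1; omega
  have hcjm : m * (2 : ℚ) ^ (-((c : ℤ) + j)) = u * t := by rw [hmdef, huz, htdef, pw, pw]; congr 1; omega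
  have h2m : (2 : ℚ) ^ (-((k : ℤ) - 1)) = 2 * m := by rw [hmdef, two_mul_zpow]; congr 1; ring
  have h2ml : (2 : ℚ) ^ (-((l : ℤ) - 1)) = 2 * (m * g) := by rw [hml, two_mul_zpow]; congr 1; ring
  ------------------------------------------------------------------ per-child rows
  have n0 : ∀ (X : SumTree) (S : Finset ℤ), 0 ≤ treeBR q X S := fun X S => treeBR_nonneg q X S
  have rsub0 : ∀ (X : SumTree) (S : Finset ℤ), (0 : ℤ) ∈ S → Routable q S →
      0 ≤ (-1) * treeBR q X {0} + (1) * treeBR q X S := by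
    intro X S h0 hS
    have h := treeBR_le_of_subset hq1 X (B := ({0} : Finset ℤ)) (C := S)
      (by intro z hz; rw [Finset.mem_singleton] at hz; rw [hz]; exact h0) hS
    linarith only [h]
  have rowM0dl : ∀ X : SumTree, 0 ≤ (-1) * treeBR q X {0} + (1) * treeBR q X {0, -((dl : ℤ) + k)} := fun X =>
    rsub0 X _ (Finset.mem_insert_self _ _) (routable_zero_pair (by omega) (by omega))
  have rowM0cj : ∀ X : SumTree, 0 ≤ (-1) * treeBR q X {0} + (1) * treeBR q X {0, -((c : ℤ) + j)} := fun X =>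
    rsub0 X _ (Finset.mem_insert_self _ _) (routable_zero_pair (by omega) (by omega))
  have rowM0k : ∀ X : SumTree, 0 ≤ (-1) * treeBR q X {0} + (1) * treeBR q X {0, -(k : ℤ)} := fun X =>
    rsub0 X _ (Finset.mem_insert_self _ _) (routable_zero_pair (by omega) (by omega))
  have rTri : ∀ (a b : ℕ), 1 ≤ a → a < b → b + 1 ≤ q → Routable q ({0, -(a : ℤ), -(b : ℤ)} : Finset ℤ) := by
    intro a b ha hab hbq x hx y hy
    simp only [Finset.mem_insert, Finset.mem_singleton] at hx hy
    rcases hx with rfl | rfl | rfl <;> rcases hy with rfl | rfl | rfl <;> omega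
  have rowM0jk : ∀ X : SumTree, 0 ≤ (-1) * treeBR q X {0} + (1) * treeBR q X {0, -(j : ℤ), -(k : ℤ)} := fun X =>
    rsub0 X _ (Finset.mem_insert_self _ _) (rTri j k (by omega) hjk (by omega))
  have rowPhi3jk : ∀ X : SumTree, 0 ≤ (-1) * treeBR q X {0, -((k : ℤ) - 1)} + (1 - u) * treeBR q X {0, -(k : ℤ)} +
      (m) * treeBR q X {0, -(c : ℤ), -((c : ℤ) + j)} + (u*m) * treeBR q X {0, -((c : ℤ) + j)} := by
    intro X
    have h := treeBR_phi3 hq4 hj hjk (by omega) X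
    rw [← hc, ← hudef, ← hmdef] at h
    linarith only [h]
  have rowPhi3kl : ∀ X : SumTree, 0 ≤ (-1) * treeBR q X {0, -((l : ℤ) - 1)} + (1 - u) * treeBR q X {0, -(l : ℤ)} +
      (m*g) * treeBR q X {0, -(dl : ℤ), -((dl : ℤ) + k)} + (u*m*g) * treeBR q X {0, -((dl : ℤ) + k)} := by
    intro X
    have h := treeBR_phi3 hq4 (j := k) (k := l) (by omega) hkl hlq X
    rw [← hdl, ← hudef, ← hml] at h
    linarith only [h]
  have rowMC : ∀ (X : SumTree) (i : ℕ), 1 ≤ i → i + 2 ≤ q →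
      0 ≤ (-2) * treeBR q X {0, -((i : ℤ) + 1)} + (1) * treeBR q X {0, -(i : ℤ)} + (1) * treeBR q X {0} := by
    intro X i hi hiq
    have h := two_treeBR_pair_le (q := q) X (e := -((i : ℤ) + 1)) (by omega) (by omega)
    rw [show -((i : ℤ) + 1) + 1 = -(i : ℤ) by ring] at h
    linarith only [h]
  have rowMC2 : ∀ X : SumTree, 0 ≤ (-2) * treeBR q X {0, -(s : ℤ), -((c : ℤ) + 1)} +
      (1) * treeBR q X {0, -(s : ℤ), -(c : ℤ)} + (1) * treeBR q X {0, -(s : ℤ)} := by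
    intro X
    have h := two_treeBR_triple_le (q := q) X (s := s) (i := c + 1) hs1 (by omega) (by omega)
    have e1 : ({0, -(s : ℤ), -((c + 1 : ℕ) : ℤ)} : Finset ℤ) = {0, -(s : ℤ), -((c : ℤ) + 1)} := by push_cast; rfl
    have e2 : ({0, -(s : ℤ), -(((c + 1 : ℕ) : ℤ) - 1)} : Finset ℤ) = {0, -(s : ℤ), -(c : ℤ)} := by
      ext z; simp only [Finset.mem_insert, Finset.mem_singleton]; omega
    rw [e1, e2] at h
    linarith only [h]
  have rowGC2 : ∀ X : SumTree, 0 ≤ (-2 + 2*t) * treeBR q X {0, -(s : ℤ), -((c : ℤ) + 1)} +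
      (1) * treeBR q X {0, -(s : ℤ), -((c : ℤ) + j)} + (1 - 2*t) * treeBR q X {0, -(s : ℤ), -(c : ℤ)} := by
    intro X
    have h := treeBR_gcB1_triple (q := q) X (s := s) (i := c) (n := j) hs1 (by omega) hj (by omega)
    rw [← htdef] at h; exact h
  -- options at a node: x_(k,l)
  have optKL : ∀ A B : SumTree,
      1 + ((1) * treeBR q A {0, -(k : ℤ), -(l : ℤ)} + (u) * treeBR q B {0}) ≤ treeBR q (.node A B) {0, -(k : ℤ), -(l : ℤ)} ∧
      1 + ((1) * treeBR q A {0, -(k : ℤ)} + (m*g) * treeBR q B {0, -(dl : ℤ)}) ≤ treeBR q (.node A B) {0, -(k : ℤ), -(l : ℤ)} ∧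
      1 + ((1) * treeBR q A {0, -(l : ℤ)} + (m) * treeBR q B {0, -(c : ℤ)}) ≤ treeBR q (.node A B) {0, -(k : ℤ), -(l : ℤ)} ∧
      1 + ((1) * treeBR q A {0} + (m) * treeBR q B {0, -(s : ℤ), -(c : ℤ)}) ≤ treeBR q (.node A B) {0, -(k : ℤ), -(l : ℤ)} := by
    intro A B
    obtain ⟨s1, s2, s3, s4⟩ := treeBR_triple_node_ge hq1 A B (a := k) (b := l) (by omega) hkl hlq
    have e1 : treeBR q B {-(q : ℤ)} = u * treeBR q B {0} := by rw [treeBR_single_shift, huz]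
    have e2 : treeBR q B {-(l : ℤ), -(q : ℤ)} = (m * g) * treeBR q B {0, -(dl : ℤ)} := by
      rw [hml, ← treeBR_pair_shift B (-(l : ℤ)) (-(dl : ℤ))]; congr 1; ext z; simp; omega
    have e3 : treeBR q B {-(k : ℤ), -(q : ℤ)} = m * treeBR q B {0, -(c : ℤ)} := by
      rw [hmdef, ← treeBR_pair_shift B (-(k : ℤ)) (-(c : ℤ))]; congr 1; ext z; simp; omega
    have e4 : treeBR q B {-(k : ℤ), -(l : ℤ), -(q : ℤ)} = m * treeBR q B {0, -(s : ℤ), -(c : ℤ)} := by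
      rw [hmdef, ← treeBR_triple_shift B (-(k : ℤ)) (-(s : ℤ)) (-(c : ℤ))]; congr 1; ext z; simp; omega
    rw [e1] at s1; rw [e2] at s2; rw [e3] at s3; rw [e4] at s4
    exact ⟨by linarith only [s1], by linarith only [s2], by linarith only [s3], by linarith only [s4]⟩
  -- options at a node: x_(s,c,c+j) (four bits: part 10k-0)
  have optP3 : ∀ A B : SumTree,
      1 + ((1) * treeBR q A {0, -(s : ℤ), -(c : ℤ), -((c : ℤ) + j)} + (u) * treeBR q B {0}) ≤
        treeBR q (.node A B) {0, -(s : ℤ), -(c : ℤ), -((c : ℤ) + j)} ∧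
      1 + ((1) * treeBR q A {0, -(c : ℤ), -((c : ℤ) + j)} + (g) * treeBR q B {0, -((dl : ℤ) + k)}) ≤
        treeBR q (.node A B) {0, -(s : ℤ), -(c : ℤ), -((c : ℤ) + j)} ∧
      1 + ((1) * treeBR q A {0, -((c : ℤ) + j)} + (g) * treeBR q B {0, -(dl : ℤ), -((dl : ℤ) + k)}) ≤
        treeBR q (.node A B) {0, -(s : ℤ), -(c : ℤ), -((c : ℤ) + j)} ∧
      (m) + ((m) * treeBR q A {0, -(s : ℤ)} + (u) * treeBR q B {0, -(j : ℤ), -(k : ℤ)}) ≤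
        (m) * treeBR q (.node A B) {0, -(s : ℤ), -(c : ℤ), -((c : ℤ) + j)} ∧
      (m) + ((m) * treeBR q A {0, -(s : ℤ), -((c : ℤ) + j)} + (u) * treeBR q B {0, -(k : ℤ)}) ≤
        (m) * treeBR q (.node A B) {0, -(s : ℤ), -(c : ℤ), -((c : ℤ) + j)} := by
    intro A B
    have h := phi3p_optP3 (q := q) hq1 (s := s) (c := c) (j := j) (k := k) (dl := dl) hs1 hsc (by omega) (by omega)
      (by omega) (by omega) A B
    rw [← huz, ← hgdef, ← hmdef] at h
    exact h
  -- options at a node: x_(s,c+j)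
  have optPJ : ∀ A B : SumTree,
      1 + ((1) * treeBR q A {0, -(s : ℤ), -((c : ℤ) + j)} + (u) * treeBR q B {0}) ≤ treeBR q (.node A B) {0, -(s : ℤ), -((c : ℤ) + j)} ∧
      1 + ((1) * treeBR q A {0, -((c : ℤ) + j)} + (g) * treeBR q B {0, -((dl : ℤ) + k)}) ≤ treeBR q (.node A B) {0, -(s : ℤ), -((c : ℤ) + j)} ∧
      (m) + ((m) * treeBR q A {0, -(s : ℤ)} + (u*t) * treeBR q B {0, -((k : ℤ) - j)}) ≤
        (m) * treeBR q (.node A B) {0, -(s : ℤ), -((c : ℤ) + j)} := by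
    intro A B
    obtain ⟨s1, s2, s3, -⟩ := treeBR_triple_node_ge hq1 A B (a := s) (b := c + j) hs1 (by omega) (by omega)
    have e0 : ({0, -(s : ℤ), -((c + j : ℕ) : ℤ)} : Finset ℤ) = {0, -(s : ℤ), -((c : ℤ) + j)} := by push_cast; rfl
    have e0' : ({0, -((c + j : ℕ) : ℤ)} : Finset ℤ) = {0, -((c : ℤ) + j)} := by push_cast; rfl
    rw [e0] at s1 s2 s3; rw [e0'] at s3
    have e1 : treeBR q B {-(q : ℤ)} = u * treeBR q B {0} := by rw [treeBR_single_shift, huz]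
    have e2 : treeBR q B {-((c + j : ℕ) : ℤ), -(q : ℤ)} = (2 : ℚ) ^ (-((c : ℤ) + j)) * treeBR q B {0, -((k : ℤ) - j)} := by
      rw [← treeBR_pair_shift B (-((c : ℤ) + j)) (-((k : ℤ) - j))]; congr 1; ext z; simp; omega
    have e3 : treeBR q B {-(s : ℤ), -(q : ℤ)} = g * treeBR q B {0, -((dl : ℤ) + k)} := by
      rw [hgdef, ← treeBR_pair_shift B (-(s : ℤ)) (-((dl : ℤ) + k))]; congr 1; ext z; simp; omega
    rw [e1] at s1; rw [e2] at s2; rw [e3] at s3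
    refine ⟨by linarith only [s1], by linarith only [s3], ?_⟩
    have s2' := mul_le_mul_of_nonneg_left s2 hm0.le
    have e4 : m * (1 + (treeBR q A {0, -(s : ℤ)} + (2 : ℚ) ^ (-((c : ℤ) + j)) * treeBR q B {0, -((k : ℤ) - j)})) =
        m + (m * treeBR q A {0, -(s : ℤ)} + (m * (2 : ℚ) ^ (-((c : ℤ) + j))) * treeBR q B {0, -((k : ℤ) - j)}) := by ring
    rw [e4, hcjm] at s2'
    linarith only [s2']
  -- symmetry of the node
  have comm : ∀ (A B : SumTree) (S : Finset ℤ), treeBR q (.node B A) S = treeBR q (.node A B) S :=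
    fun A B S => by unfold treeBR; exact treeBRw_node_comm q _ B A S
  ------------------------------------------------------------------ the induction
  intro tr
  induction tr with
  | leaf z => simp [treeBR]
  | node A B ihA ihB =>
    set NKL := treeBR q (.node A B) {0, -(k : ℤ), -(l : ℤ)} with hNKL
    set NP3 := treeBR q (.node A B) {0, -(s : ℤ), -(c : ℤ), -((c : ℤ) + j)} with hNP3
    set NPJ := treeBR q (.node A B) {0, -(s : ℤ), -((c : ℤ) + j)} with hNPJ
    obtain ⟨oKL0ab, oKLKab, oKLLab, oKL1ab⟩ := optKL A B
    obtain ⟨oKL0ba, oKLKba, oKLLba, oKL1ba⟩ := optKL B A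
    obtain ⟨oP30ab, oP3Kab, oP3Lab, oP3Sab, oP3Jab⟩ := optP3 A B
    obtain ⟨oP30ba, oP3Kba, oP3Lba, oP3Sba, oP3Jba⟩ := optP3 B A
    obtain ⟨oPJ0ab, oPJKab, oPJSab⟩ := optPJ A B
    obtain ⟨oPJ0ba, oPJKba, oPJSba⟩ := optPJ B A
    rw [comm] at oKL0ba oKLKba oKLLba oKL1ba oP30ba oP3Kba oP3Lba oP3Sba oP3Jba oPJ0ba oPJKba oPJSba
    have ihA' : 0 ≤ (-1) * treeBR q A {0, -((k : ℤ) - 1), -((l : ℤ) - 1)} + (1 - u) * treeBR q A {0, -(k : ℤ), -(l : ℤ)} +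
        (m) * treeBR q A {0, -(s : ℤ), -(c : ℤ), -((c : ℤ) + j)} + (u*m) * treeBR q A {0, -(s : ℤ), -((c : ℤ) + j)} := by
      linarith only [ihA]
    have ihB' : 0 ≤ (-1) * treeBR q B {0, -((k : ℤ) - 1), -((l : ℤ) - 1)} + (1 - u) * treeBR q B {0, -(k : ℤ), -(l : ℤ)} +
        (m) * treeBR q B {0, -(s : ℤ), -(c : ℤ), -((c : ℤ) + j)} + (u*m) * treeBR q B {0, -(s : ℤ), -((c : ℤ) + j)} := by
      linarith only [ihB]
    -- R ≥ 0
    have hR : 0 ≤ (1 - u) * NKL + (m) * NP3 + (u*m) * NPJ - 1 := by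
      have h1 : 1 ≤ NKL := by linarith only [oKL0ab, n0 A {0, -(k : ℤ), -(l : ℤ)}, mul_nonneg hu0.le (n0 B {0})]
      have h2 : 1 ≤ NP3 := by
        linarith only [oP30ab, n0 A {0, -(s : ℤ), -(c : ℤ), -((c : ℤ) + j)}, mul_nonneg hu0.le (n0 B {0})]
      have h3 : 0 ≤ (u*m) * NPJ := mul_nonneg (mul_nonneg hu0.le hm0.le) (n0 _ _)
      have h4 := mul_le_mul_of_nonneg_left h1 (by linarith only [hu1] : (0 : ℚ) ≤ 1 - u)
      have h5 := mul_le_mul_of_nonneg_left h2 hm0.le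
      linarith only [h3, h4, h5, hmu, hu0]
    have ha' : ((k - 1 : ℕ) : ℤ) = (k : ℤ) - 1 := by omega
    have hb' : ((l - 1 : ℕ) : ℤ) = (l : ℤ) - 1 := by omega
    have key := treeBR_three_node_le hq1 A B (a := k - 1) (b := l - 1) (by omega) (by omega) (by omega) hR ?_
    · rw [ha', hb'] at key; linarith only [key]
    rw [ha', hb']
    -- shifts of the raw option expressions
    have eq1 : ∀ X : SumTree, treeBR q X {-(q : ℤ)} = u * treeBR q X {0} := fun X => by
      rw [treeBR_single_shift, huz]
    have eq2 : ∀ X : SumTree, treeBR q X {-((l : ℤ) - 1), -(q : ℤ)} = 2 * (m * g) * treeBR q X {0, -((dl : ℤ) + 1)} := fun X => by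
      rw [← h2ml, ← treeBR_pair_shift X (-((l : ℤ) - 1)) (-((dl : ℤ) + 1))]; congr 1; ext z; simp; omega
    have eq3 : ∀ X : SumTree, treeBR q X {-((k : ℤ) - 1), -(q : ℤ)} = 2 * m * treeBR q X {0, -((c : ℤ) + 1)} := fun X => by
      rw [← h2m, ← treeBR_pair_shift X (-((k : ℤ) - 1)) (-((c : ℤ) + 1))]; congr 1; ext z; simp; omega
    have eq4 : ∀ X : SumTree, treeBR q X {-((k : ℤ) - 1), -((l : ℤ) - 1), -(q : ℤ)} =
        2 * m * treeBR q X {0, -(s : ℤ), -((c : ℤ) + 1)} := fun X => by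
      rw [← h2m, ← treeBR_triple_shift X (-((k : ℤ) - 1)) (-(s : ℤ)) (-((c : ℤ) + 1))]; congr 1; ext z; simp; omega
    rw [eq1, eq1, eq2, eq2, eq3, eq3, eq4, eq4]
    -- gap-convexity rows in the generated shapes
    have gcK : ∀ X : SumTree, 0 ≤ (-2 + 2*m) * treeBR q X {0, -((dl : ℤ) + 1)} + (1) * treeBR q X {0, -((dl : ℤ) + k)} +
        (1 - 2*m) * treeBR q X {0, -(dl : ℤ)} := fun X => by
      have h := treeBR_gcB1_pair (q := q) X (i := dl) (n := k) hdl1 (by omega) (by omega)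
      rw [← hmdef] at h; exact h
    have gcL : ∀ X : SumTree, 0 ≤ (-2 + 2*t) * treeBR q X {0, -((c : ℤ) + 1)} + (1) * treeBR q X {0, -((c : ℤ) + j)} +
        (1 - 2*t) * treeBR q X {0, -(c : ℤ)} := fun X => by
      have h := treeBR_gcB1_pair (q := q) X (i := c) (n := j) (by omega) hj (by omega)
      rw [← htdef] at h; exact h
    -- the eight branches
    have bA := phi3_branch1 hu0 hmu htm ht4 oKL0ab oP30ab oPJ0ab ihA' (n0 B {0})
    have bA' := phi3_branch1 hu0 hmu htm ht4 oKL0ba oP30ba oPJ0ba ihB' (n0 A {0})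
    have bK := phi3p_branchK hu0 hmu htm ht4 hgm oKLKab oP3Kab oPJKab (rowPhi3jk A) (rowMC B dl hdl1 (by omega)) (gcK B)
      (rowM0dl B)
    have bK' := phi3p_branchK hu0 hmu htm ht4 hgm oKLKba oP3Kba oPJKba (rowPhi3jk B) (rowMC A dl hdl1 (by omega)) (gcK A)
      (rowM0dl A)
    have bL := phi3p_branchL hu0 hmu htm ht4 oKLLab oP3Lba oPJKba (rowPhi3kl A) (rowMC B c (by omega) (by omega)) (gcL B)
      (rowM0cj B)
    have bL' := phi3p_branchL hu0 hmu htm ht4 oKLLba oP3Lab oPJKab (rowPhi3kl B) (rowMC A c (by omega) (by omega)) (gcL A)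
      (rowM0cj A)
    have b0 := phi3p_branch0 hu0 hmu htm ht4 oKL1ab oP3Sba oP3Jba oPJSba (rowMC2 B) (rowGC2 B)
      (rowM0jk A) (rowM0k A) (n0 A _)
    have b0' := phi3p_branch0 hu0 hmu htm ht4 oKL1ba oP3Sab oP3Jab oPJSab (rowMC2 A) (rowGC2 A)
      (rowM0jk B) (rowM0k B) (n0 B _)
    refine max_le (max_le (max_le ?_ ?_) (max_le ?_ ?_)) (max_le (max_le ?_ ?_) (max_le ?_ ?_))
    · linarith only [bA]
    · linarith only [bK]
    · linarith only [bL]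
    · linarith only [b0]
    · linarith only [bA']
    · linarith only [bK']
    · linarith only [bL']
    · linarith only [b0']

end Phi3p

end Summit.Ventures.CertifiedArithmetic.LowPrec.Opt
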